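import Summits.QuantumFields.YangMills.Theorems.UnitScaleTiltProp7TransplantGen0Arithmetic
import HarnessLib

/-!
# Route `UnitScaleTilt`, crux K1 «MinimiserStabilityRegPr» (stmt-QuantumFields-19200), route-R E′ path (α′), (E1-b) at the CURVED background — (A-cov) gen-1, FILE «GEN-1 ARITHMETIC»:
# THE `ℓ`-BOOKKEEPING OF THE THREE gen-1 NUMBERS `N2₁ H₁ S₁` OF routeR-w6 g7's `exists_gen1_package` (their right-hand sides VERBATIM under `((L^k:ℕ):ℝ) ↦ ℓ₁`, `(L:ℝ)^k ↦ ℓ`, `((9L^k:ℕ):ℝ) ↦ r9`,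
# `((45L^k:ℕ):ℝ) ↦ r45`, `((9L^k+L^k:ℕ):ℝ) ↦ r10`, `((L^k·sitesPerDir k:ℕ):ℝ) ↦ LT`, `#S ↦ card`, `#S′ ↦ card'`, `P.d ↦ d = 3`): under the cone-letter sizes `A₀ℓ² ≤ α`, `A₁ℓ² ≤ α`, `A₂ℓ³ ≤ α`,
# the weight count `W₀ ≤ w·ℓ√ℓ`, the Poincaré constant `A ≤ c_A·ℓ²`, `ℓ ≤ LT` and the ball counts, the gen-1 half of the door total is `N2₁ + W₀·(3H₁ + 5A·S₁) ≤ c₁·ℓ·(D·ℓ²)` with ONE explicit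
# `c₁(C, α, Ω, w, c_A, √N)` — every power of `ℓ` cancels (`D ≍ ℓ⁻²‖X‖`, so `D·ℓ²` is the member's `‖X‖`-currency; px22 g3's ✓p681742 `gen0_total_le` is the gen-0 half)

Cell `ym3-torus`, width seat `ym3-torus-px11` (gen 4); routeR-w6 g7 01:04Z «GEN-1 ARITHMETIC → px11» (spec + order table), px11 LOCATE-GEN1-DESIGN (D2)(D3)(D5).  Pure real arithmetic.  THEOREMS ONLY
(0 `def`, 0 `sorry`); `--supports stmt-QuantumFields-19200`, count-neutral.  YM₃ on T³ is a ladder rung (R3), not the Clay problem; nothing here claims the stub, the crux, d = 4 or the gap.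

WHAT IS PROVED (ns `…Theorems.Prop7TransplantGen1Arithmetic`): §1 letters `junk_pair_le`, `lin_le`, `sqrt_mul_cube`, `le_div_sqrt_of_mul_le`; §2 ★★★ `gen1_total_le` with
`c₁ := √N·C·(22341248 + 10648(g₁ + t_b)) + 3wΩ√N·C·(104·t_b + √h) + 5w·c_A·Ω√N·(C√s₁ + √s₂)`, `c_d := 10√3 + 6`, `g₁ := 15624 + 1031184(1 + c_d²)`, `t_b := 3(76384(26α + 484α²) + 44α(59024 + 57288c_d))`,
`h := 21296g₁² + 2·1736²·1928`, `σ₁ := 3(92α + 484α²)`, `s₁ := 2801520σ₁² + 60496128α²`, `s₂ := 32000·1737² + 4085178624C²`.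
HONEST SCOPE.  Bookkeeping; the member file (px22 g3) adds the two halves.

References: T. Bałaban, CMP 96 (1984) 223–250 [Balaban1984PropagatorsII] ((1.9) p.226); CMP 99 (1985) 75–102 [Balaban1985RegularSpaces] ((1.36) p.82).
-/

set_option autoImplicit false

noncomputable section

namespace Summit.QuantumFields.YangMills.Theorems.Prop7TransplantGen1Arithmetic

open Prop7TransplantGen0Arithmetic (pow_three_le sqrt_le_mul_sqrt weight_count_mul_le)

/-! ## §1 Letters -/

/-- the cone junk pair on the `10ℓ`-ball: `(2(A₀ + A₂(10ℓ+2)) + 4(A₁(10ℓ+1))²)·ℓ² ≤ 26α + 484α²`. [folklore] -/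
theorem junk_pair_le {ℓ α A₀ A₁ A₂ : ℝ} (hℓ : 1 ≤ ℓ) (hA₁0 : 0 ≤ A₁) (hA₂0 : 0 ≤ A₂)
    (hA₀ : A₀ * ℓ ^ 2 ≤ α) (hA₁ : A₁ * ℓ ^ 2 ≤ α) (hA₂ : A₂ * ℓ ^ 3 ≤ α) :
    ((2 * (A₀ + A₂ * (9 * ℓ + ℓ + 2)) + 4 * (A₁ * (9 * ℓ + ℓ + 1)) ^ 2)) * ℓ ^ 2 ≤ 26 * α + 484 * α ^ 2 := by
  have hℓ0 : 0 < ℓ := by linarith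
  have hα : 0 ≤ α := le_trans (by positivity) hA₁
  have h12 : A₂ * (9 * ℓ + ℓ + 2) * ℓ ^ 2 ≤ 12 * α := by
    have : A₂ * (9 * ℓ + ℓ + 2) ≤ A₂ * (12 * ℓ) := mul_le_mul_of_nonneg_left (by linarith) hA₂0
    nlinarith
  have h11 : (A₁ * (9 * ℓ + ℓ + 1)) ^ 2 * ℓ ^ 2 ≤ 121 * α ^ 2 := by
    have h' : A₁ * (9 * ℓ + ℓ + 1) ≤ 11 * (A₁ * ℓ) := by nlinarith
    have h'' : (A₁ * (9 * ℓ + ℓ + 1)) ^ 2 ≤ (11 * (A₁ * ℓ)) ^ 2 := pow_le_pow_left₀ (by positivity) h' 2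
    have h3 : (11 * (A₁ * ℓ)) ^ 2 * ℓ ^ 2 = 121 * (A₁ * ℓ ^ 2) ^ 2 := by ring
    have h4 : (A₁ * ℓ ^ 2) ^ 2 ≤ α ^ 2 := pow_le_pow_left₀ (by positivity) hA₁ 2
    nlinarith [pow_nonneg hℓ0.le 2]
  have e : ((2 * (A₀ + A₂ * (9 * ℓ + ℓ + 2)) + 4 * (A₁ * (9 * ℓ + ℓ + 1)) ^ 2)) * ℓ ^ 2
      = 2 * (A₀ * ℓ ^ 2) + 2 * (A₂ * (9 * ℓ + ℓ + 2) * ℓ ^ 2) + 4 * ((A₁ * (9 * ℓ + ℓ + 1)) ^ 2 * ℓ ^ 2) := by ring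
  rw [e]
  nlinarith

/-- `A₁(10ℓ+1)·ℓ ≤ 11α`. [folklore] -/
theorem lin_le {ℓ α A₁ : ℝ} (hℓ : 1 ≤ ℓ) (hA₁0 : 0 ≤ A₁) (hA₁ : A₁ * ℓ ^ 2 ≤ α) : A₁ * (9 * ℓ + ℓ + 1) * ℓ ≤ 11 * α := by
  have h' : A₁ * (9 * ℓ + ℓ + 1) ≤ 11 * (A₁ * ℓ) := by nlinarith
  nlinarith

/-- `√(K·ℓ³) = √K·ℓ·√ℓ` (`K, ℓ ≥ 0`). [folklore] -/
theorem sqrt_mul_cube {K ℓ : ℝ} (hK : 0 ≤ K) (hℓ : 0 ≤ ℓ) : Real.sqrt (K * ℓ ^ 3) = Real.sqrt K * ℓ * Real.sqrt ℓ := by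
  have e : K * ℓ ^ 3 = K * (ℓ ^ 2 * ℓ) := by ring
  rw [e, Real.sqrt_mul hK, Real.sqrt_mul (sq_nonneg ℓ), Real.sqrt_sq hℓ]
  ring

/-- `R·ℓ ≤ K`, `0 ≤ R`, `0 < ℓ` ⇒ `√R ≤ √K ∕ √ℓ`. [folklore] -/
theorem sqrt_le_div_sqrt_of_mul_le {R K ℓ : ℝ} (hℓ : 0 < ℓ) (h : R * ℓ ≤ K) : Real.sqrt R ≤ Real.sqrt K / Real.sqrt ℓ := by
  rw [le_div_iff₀ (Real.sqrt_pos.2 hℓ), ← Real.sqrt_mul' R hℓ.le]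
  exact Real.sqrt_le_sqrt h

/-! ## §2 ★★★ The gen-1 half of the door total is linear in `ℓ` -/

set_option maxHeartbeats 400000 in
/-- ★★★ **THE gen-1 HALF OF `htot` IS `≤ c₁·ℓ·(D·ℓ²)`** (see the module docstring; `#S ≍ #S′ ≍ ℓ³`, `W₀ ≍ ℓ√ℓ`, `A ≍ ℓ²`, `N2₁ ≍ ℓ`, `H₁ ≍ ℓ^{−1∕2}`, `S₁ ≍ ℓ^{−5∕2}` in units of `D·ℓ²`).
[cite: Balaban1984PropagatorsII, (1.9) p.226; Balaban1985RegularSpaces, (1.36) p.82] -/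
theorem gen1_total_le {d : ℕ} (hd : d = 3) (N : ℕ) {ℓ₁ ℓ r9 r45 r10 LT card card' : ℝ} (hℓ₁ : ℓ₁ = ℓ) (hℓ : 3 ≤ ℓ)
    (hr9 : r9 = 9 * ℓ) (hr45 : r45 = 45 * ℓ) (hr10 : r10 = 9 * ℓ + ℓ) (hLT : ℓ ≤ LT)
    (hcard : card ≤ (2 * (9 * ℓ₁ + 1)) ^ d) (hcard' : card' ≤ (2 * (9 * ℓ₁ + ℓ + 1)) ^ d)
    {C D α Ω W₀ w A cA A₀ A₁ A₂ : ℝ} (hC : 0 ≤ C) (hD : 0 ≤ D) (hΩ : 0 ≤ Ω) (hw : 0 ≤ w)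
    (hA₀0 : 0 ≤ A₀) (hA₁0 : 0 ≤ A₁) (hA₂0 : 0 ≤ A₂) (hA₀ : A₀ * ℓ ^ 2 ≤ α) (hA₁ : A₁ * ℓ ^ 2 ≤ α) (hA₂ : A₂ * ℓ ^ 3 ≤ α)
    (hW₀ : W₀ ≤ w * ℓ * Real.sqrt ℓ) (hA0 : 0 ≤ A) (hA : A ≤ cA * ℓ ^ 2) :
    -- N2₁
    (Real.sqrt N * (Real.sqrt card * Real.sqrt ((C * D) ^ 2 * (3 * r45) * (8 + 128 * r9 ^ 2)) + (card' * (((d : ℝ) * (2 * (3 / (2 * ℓ₁)) * (C * (D * (8 + 192 * r9))) + 9 / ℓ₁ ^ 2 * (C * (D * (8 + 192 * r9)) * (3 + 18 * ℓ₁ + ℓ))) + (C * (D * (8 + 192 * r9)) * (3 + 18 * ℓ₁ + ℓ)) * (9 * (d : ℝ) * (10 * Real.sqrt d + 6) ^ 2 / ℓ ^ 2))) + (C * (D * (8 + 192 * r9))) * (8 + 128 * r10 ^ 2)))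
        + Real.sqrt N * (card' * ((d : ℝ) * ((2 * (A₀ + A₂ * (r10 + 2)) + 4 * (A₁ * (r10 + 1)) ^ 2) * (2 * (C * (D * (8 + 192 * r9)) * (3 + 18 * ℓ₁ + ℓ))) + 4 * (A₁ * (r10 + 1)) * (C * (D * (8 + 192 * r9)) + 3 / (2 * ℓ₁) * (C * (D * (8 + 192 * r9)) * (3 + 18 * ℓ₁ + ℓ)) + (C * (D * (8 + 192 * r9)) * (3 + 18 * ℓ₁ + ℓ)) * (3 * (10 * Real.sqrt d + 6) / (2 * ℓ)))))))
    -- W₀·(3H₁ + 5A·S₁)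
    + W₀ * (3 * (Ω * (Real.sqrt N * (Real.sqrt card' * ((d : ℝ) * ((2 * (A₀ + A₂ * (r10 + 2)) + 4 * (A₁ * (r10 + 1)) ^ 2) * (2 * (C * (D * (8 + 192 * r9)) * (3 + 18 * ℓ₁ + ℓ))) + 4 * (A₁ * (r10 + 1)) * (C * (D * (8 + 192 * r9)) + 3 / (2 * ℓ₁) * (C * (D * (8 + 192 * r9)) * (3 + 18 * ℓ₁ + ℓ)) + (C * (D * (8 + 192 * r9)) * (3 + 18 * ℓ₁ + ℓ)) * (3 * (10 * Real.sqrt d + 6) / (2 * ℓ)))))))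
          + Ω * Real.sqrt (N * (2 * (card' * (((d : ℝ) * (2 * (3 / (2 * ℓ₁)) * (C * (D * (8 + 192 * r9))) + 9 / ℓ₁ ^ 2 * (C * (D * (8 + 192 * r9)) * (3 + 18 * ℓ₁ + ℓ))) + (C * (D * (8 + 192 * r9)) * (3 + 18 * ℓ₁ + ℓ)) * (9 * (d : ℝ) * (10 * Real.sqrt d + 6) ^ 2 / ℓ ^ 2))) ^ 2) + 2 * ((C * (D * (8 + 192 * r9))) ^ 2 * (8 + 192 * r10)))))
        + 5 * A * (Ω * (Real.sqrt N * Real.sqrt (2 * (((d : ℝ) * ((2 * (A₀ + A₂ * (r10 + 2)) + 4 * (A₁ * (r10 + 1)) ^ 2) * (C * D) + 4 * (A₁ * (r10 + 1)) * (3 / (2 * ℓ₁) * (C * D)))) ^ 2 * (3 * r45) * (8 + 128 * r9 ^ 2))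
            + 2 * (((d : ℝ) * (4 * (A₁ * (r10 + 1)) * (C * D))) ^ 2 * (8 + 192 * r9))))
          + Ω * Real.sqrt (N * (4 * (card * (D / ℓ₁ ^ 2 + (((LT) ^ d)⁻¹ * (D * (8 + 192 * r9)))) ^ 2) + 4 * (((d : ℝ) * (2 * (3 / (2 * ℓ₁))) * (C * D)) ^ 2 * (8 + 192 * r9)) + 2 * (((d : ℝ) * (9 / ℓ₁ ^ 2) * (C * D)) ^ 2 * (2 * (3 * r45)) * (8 + 128 * r9 ^ 2))))))
    ≤ (Real.sqrt N * C * (22341248 + 10648 * ((15624 + 1031184 * (1 + (10 * Real.sqrt 3 + 6) ^ 2)) + 3 * (76384 * (26 * α + 484 * α ^ 2) + 44 * α * (59024 + 57288 * (10 * Real.sqrt 3 + 6)))))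
        + 3 * w * Ω * Real.sqrt N * C * (104 * (3 * (76384 * (26 * α + 484 * α ^ 2) + 44 * α * (59024 + 57288 * (10 * Real.sqrt 3 + 6))))
            + Real.sqrt (21296 * (15624 + 1031184 * (1 + (10 * Real.sqrt 3 + 6) ^ 2)) ^ 2 + 2 * 1736 ^ 2 * 1928))
        + 5 * w * cA * Ω * Real.sqrt N * (C * Real.sqrt (2801520 * (3 * (92 * α + 484 * α ^ 2)) ^ 2 + 60496128 * α ^ 2) + Real.sqrt (32000 * 1737 ^ 2 + 4085178624 * C ^ 2)))
      * ℓ * (D * ℓ ^ 2) := by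
  subst hd; subst hr9; subst hr45; subst hr10; subst hℓ₁
  have hd3 : ((3 : ℕ) : ℝ) = 3 := by norm_num
  simp only [hd3]
  -- letters
  have hℓ1 : (1 : ℝ) ≤ ℓ₁ := by linarith
  have hℓ0 : (0 : ℝ) < ℓ₁ := by linarith
  have hL1raw : A₁ * (9 * ℓ₁ + ℓ₁ + 1) * ℓ₁ ≤ 11 * α := lin_le hℓ1 hA₁0 hA₁
  have hJ2raw : (2 * (A₀ + A₂ * (9 * ℓ₁ + ℓ₁ + 2)) + 4 * (A₁ * (9 * ℓ₁ + ℓ₁ + 1)) ^ 2) * ℓ₁ ^ 2 ≤ 26 * α + 484 * α ^ 2 :=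
    junk_pair_le hℓ1 hA₁0 hA₂0 hA₀ hA₁ hA₂
  obtain ⟨hP, hQ⟩ := pow_three_le hℓ1
  set cd : ℝ := 10 * Real.sqrt 3 + 6 with hcd
  have hcd0 : 0 ≤ cd := by rw [hcd]; positivity
  set sN : ℝ := Real.sqrt N with hsN
  have hsN0 : 0 ≤ sN := Real.sqrt_nonneg _
  have hsNsq : sN ^ 2 = N := Real.sq_sqrt (Nat.cast_nonneg _)
  set s : ℝ := Real.sqrt ℓ₁ with hs
  have hs0 : 0 < s := Real.sqrt_pos.2 hℓ0
  have hsne : s ≠ 0 := hs0.ne'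
  have hℓne : ℓ₁ ≠ 0 := hℓ0.ne'
  have hss : s * s = ℓ₁ := Real.mul_self_sqrt hℓ0.le
  have hα : 0 ≤ α := le_trans (by positivity) hA₁
  have hCD : 0 ≤ C * D := mul_nonneg hC hD
  set E : ℝ := D * (8 + 192 * (9 * ℓ₁)) with hEdef
  set Φp : ℝ := C * E * (3 + 18 * ℓ₁ + ℓ₁) with hΦpdef
  set L1 : ℝ := A₁ * (9 * ℓ₁ + ℓ₁ + 1) with hL1def
  set J2 : ℝ := 2 * (A₀ + A₂ * (9 * ℓ₁ + ℓ₁ + 2)) + 4 * L1 ^ 2 with hJ2def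
  set G : ℝ := 3 * (2 * (3 / (2 * ℓ₁)) * (C * E) + 9 / ℓ₁ ^ 2 * Φp) + Φp * (9 * 3 * cd ^ 2 / ℓ₁ ^ 2) with hGdef
  set Φ1 : ℝ := C * E + 3 / (2 * ℓ₁) * Φp + Φp * (3 * cd / (2 * ℓ₁)) with hΦ1def
  set Tb : ℝ := 3 * (J2 * (2 * Φp) + 4 * L1 * Φ1) with hTbdef
  set cR : ℝ := 3 * (J2 * (C * D) + 4 * L1 * (3 / (2 * ℓ₁) * (C * D))) with hcRdef
  set cS : ℝ := 3 * (4 * L1 * (C * D)) with hcSdef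
  set a3 : ℝ := D / ℓ₁ ^ 2 + (LT ^ 3)⁻¹ * E with ha3def
  set a2 : ℝ := 3 * (2 * (3 / (2 * ℓ₁))) * (C * D) with ha2def
  set a4 : ℝ := 3 * (9 / ℓ₁ ^ 2) * (C * D) with ha4def
  set g1c : ℝ := 15624 + 1031184 * (1 + cd ^ 2) with hg1c
  set tbc : ℝ := 3 * (76384 * (26 * α + 484 * α ^ 2) + 44 * α * (59024 + 57288 * cd)) with htbc
  set hhc : ℝ := 21296 * g1c ^ 2 + 2 * 1736 ^ 2 * 1928 with hhhc
  set s1c : ℝ := 2801520 * (3 * (92 * α + 484 * α ^ 2)) ^ 2 + 60496128 * α ^ 2 with hs1c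
  set s2c : ℝ := 32000 * 1737 ^ 2 + 4085178624 * C ^ 2 with hs2c
  have hg1c0 : 0 ≤ g1c := by rw [hg1c]; positivity
  have htbc0 : 0 ≤ tbc := by rw [htbc]; positivity
  have hhhc0 : 0 ≤ hhc := by rw [hhhc]; positivity
  have hs1c0 : 0 ≤ s1c := by rw [hs1c]; positivity
  have hs2c0 : 0 ≤ s2c := by rw [hs2c]; positivity
  -- basic sizes
  have hℓsq : ℓ₁ ≤ ℓ₁ ^ 2 := by nlinarith only [hℓ1]
  have hℓ24 : ℓ₁ ^ 2 ≤ ℓ₁ ^ 4 := by nlinarith only [hℓsq, hℓ1]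
  have hℓ13 : ℓ₁ ≤ ℓ₁ ^ 3 := by nlinarith only [hℓsq, hℓ1]
  have hE0 : 0 ≤ E := by rw [hEdef]; positivity
  have hE : E ≤ 1736 * D * ℓ₁ := by rw [hEdef]; nlinarith only [hD, hℓ1]
  have hCE : C * E ≤ 1736 * (C * D) * ℓ₁ :=
    calc C * E ≤ C * (1736 * D * ℓ₁) := mul_le_mul_of_nonneg_left hE hC
      _ = _ := by ring
  have hΦp0 : 0 ≤ Φp := by rw [hΦpdef]; positivity
  have hΦp : Φp ≤ 38192 * (C * D) * ℓ₁ ^ 2 := by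
    rw [hΦpdef]
    have h1 : 3 + 18 * ℓ₁ + ℓ₁ ≤ 22 * ℓ₁ := by linarith only [hℓ1]
    calc C * E * (3 + 18 * ℓ₁ + ℓ₁) ≤ (1736 * (C * D) * ℓ₁) * (22 * ℓ₁) := mul_le_mul hCE h1 (by positivity) (by positivity)
      _ = _ := by ring
  have hL10 : 0 ≤ L1 := by rw [hL1def]; positivity
  have hL1 : L1 * ℓ₁ ≤ 11 * α := hL1raw
  have hJ20 : 0 ≤ J2 := by rw [hJ2def]; positivity
  have hJ2 : J2 * ℓ₁ ^ 2 ≤ 26 * α + 484 * α ^ 2 := hJ2raw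
  have hG0 : 0 ≤ G := by rw [hGdef]; positivity
  have hG : G ≤ g1c * (C * D) := by
    have eG : G * ℓ₁ ^ 2 = 9 * (C * E) * ℓ₁ + 27 * Φp + 27 * cd ^ 2 * Φp := by
      rw [hGdef]; field_simp; ring
    have h1 : G * ℓ₁ ^ 2 ≤ (g1c * (C * D)) * ℓ₁ ^ 2 := by
      rw [eG, hg1c]
      have a1 : 9 * (C * E) * ℓ₁ ≤ 9 * (1736 * (C * D) * ℓ₁) * ℓ₁ :=
        mul_le_mul_of_nonneg_right (mul_le_mul_of_nonneg_left hCE (by norm_num)) hℓ0.le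
      have a2 : 27 * Φp ≤ 27 * (38192 * (C * D) * ℓ₁ ^ 2) := mul_le_mul_of_nonneg_left hΦp (by norm_num)
      have a3 : 27 * cd ^ 2 * Φp ≤ 27 * cd ^ 2 * (38192 * (C * D) * ℓ₁ ^ 2) := mul_le_mul_of_nonneg_left hΦp (mul_nonneg (by norm_num) (sq_nonneg cd))
      linarith only [a1, a2, a3]
    exact le_of_mul_le_mul_right h1 (by positivity)
  have hΦ10 : 0 ≤ Φ1 := by rw [hΦ1def]; positivity
  have hΦ1 : Φ1 ≤ (59024 + 57288 * cd) * (C * D) * ℓ₁ := by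
    have eΦ : Φ1 * ℓ₁ = C * E * ℓ₁ + 3 / 2 * Φp + 3 * cd / 2 * Φp := by
      rw [hΦ1def]; field_simp
    have h1 : Φ1 * ℓ₁ ≤ ((59024 + 57288 * cd) * (C * D) * ℓ₁) * ℓ₁ := by
      rw [eΦ]
      have a1 : C * E * ℓ₁ ≤ (1736 * (C * D) * ℓ₁) * ℓ₁ := mul_le_mul_of_nonneg_right hCE hℓ0.le
      have a2 : 3 / 2 * Φp ≤ 3 / 2 * (38192 * (C * D) * ℓ₁ ^ 2) := mul_le_mul_of_nonneg_left hΦp (by norm_num)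
      have a3 : 3 * cd / 2 * Φp ≤ 3 * cd / 2 * (38192 * (C * D) * ℓ₁ ^ 2) := mul_le_mul_of_nonneg_left hΦp (div_nonneg (mul_nonneg (by norm_num) hcd0) (by norm_num))
      linarith only [a1, a2, a3]
    exact le_of_mul_le_mul_right h1 hℓ0
  have hTb0 : 0 ≤ Tb := by rw [hTbdef]; positivity
  have hTb : Tb ≤ tbc * (C * D) := by
    rw [hTbdef, htbc]
    have a1 : J2 * (2 * Φp) ≤ 76384 * (26 * α + 484 * α ^ 2) * (C * D) := by
      have h1 : J2 * (2 * Φp) ≤ J2 * (2 * (38192 * (C * D) * ℓ₁ ^ 2)) := mul_le_mul_of_nonneg_left (by linarith only [hΦp]) hJ20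
      have e : J2 * (2 * (38192 * (C * D) * ℓ₁ ^ 2)) = 76384 * (J2 * ℓ₁ ^ 2) * (C * D) := by ring
      rw [e] at h1
      have h2 : 76384 * (J2 * ℓ₁ ^ 2) * (C * D) ≤ 76384 * (26 * α + 484 * α ^ 2) * (C * D) :=
        mul_le_mul_of_nonneg_right (by linarith only [hJ2]) hCD
      linarith only [h1, h2]
    have a2 : 4 * L1 * Φ1 ≤ 44 * α * (59024 + 57288 * cd) * (C * D) := by
      have h1 : 4 * L1 * Φ1 ≤ 4 * L1 * ((59024 + 57288 * cd) * (C * D) * ℓ₁) := mul_le_mul_of_nonneg_left hΦ1 (mul_nonneg (by norm_num) hL10)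
      have e : 4 * L1 * ((59024 + 57288 * cd) * (C * D) * ℓ₁) = 4 * (L1 * ℓ₁) * ((59024 + 57288 * cd) * (C * D)) := by ring
      rw [e] at h1
      have h2 : 4 * (L1 * ℓ₁) * ((59024 + 57288 * cd) * (C * D)) ≤ 4 * (11 * α) * ((59024 + 57288 * cd) * (C * D)) :=
        mul_le_mul_of_nonneg_right (by linarith only [hL1]) (mul_nonneg (by linarith only [hcd0]) hCD)
      linarith only [h1, h2]
    linarith only [a1, a2]
  -- counts
  have hcardP : card ≤ 8000 * ℓ₁ ^ 3 := hcard.trans hP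
  have hcardQ : card' ≤ 10648 * ℓ₁ ^ 3 := hcard'.trans hQ
  have hsqcard : Real.sqrt card ≤ 90 * ℓ₁ * s := (Real.sqrt_le_sqrt hcardP).trans (sqrt_le_mul_sqrt (by norm_num) (by norm_num) hℓ0.le)
  have hsqcard' : Real.sqrt card' ≤ 104 * ℓ₁ * s := (Real.sqrt_le_sqrt hcardQ).trans (sqrt_le_mul_sqrt (by norm_num) (by norm_num) hℓ0.le)
  have h3 : ℓ₁ ^ 3 = ℓ₁ * (ℓ₁ * ℓ₁) := by ring
  -- ===== N2 =====
  have hTa : Real.sqrt card * Real.sqrt ((C * D) ^ 2 * (3 * (45 * ℓ₁)) * (8 + 128 * (9 * ℓ₁) ^ 2)) ≤ 106560 * (C * D) * ℓ₁ ^ 3 := by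
    have hrad : (C * D) ^ 2 * (3 * (45 * ℓ₁)) * (8 + 128 * (9 * ℓ₁) ^ 2) ≤ (1400760 * (C * D) ^ 2) * ℓ₁ ^ 3 := by
      have h1 : (3 * (45 * ℓ₁)) * (8 + 128 * (9 * ℓ₁) ^ 2) ≤ 1400760 * ℓ₁ ^ 3 := by linarith only [hℓ13]
      have h2 := mul_le_mul_of_nonneg_left h1 (sq_nonneg (C * D))
      linarith only [h2]
    have h2 : Real.sqrt ((C * D) ^ 2 * (3 * (45 * ℓ₁)) * (8 + 128 * (9 * ℓ₁) ^ 2)) ≤ 1184 * (C * D) * ℓ₁ * s :=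
      (Real.sqrt_le_sqrt hrad).trans (sqrt_le_mul_sqrt (by nlinarith only [sq_nonneg (C * D)]) (by positivity) hℓ0.le)
    calc _ ≤ (90 * ℓ₁ * s) * (1184 * (C * D) * ℓ₁ * s) := mul_le_mul hsqcard h2 (Real.sqrt_nonneg _) (by positivity)
      _ = 106560 * (C * D) * (ℓ₁ * ℓ₁) * (s * s) := by ring
      _ = _ := by rw [hss, h3]; ring
  have hTbG : card' * G ≤ 10648 * ℓ₁ ^ 3 * (g1c * (C * D)) := mul_le_mul hcardQ hG hG0 (by positivity)
  have hTc : C * E * (8 + 128 * (9 * ℓ₁ + ℓ₁) ^ 2) ≤ 22234688 * (C * D) * ℓ₁ ^ 3 := by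
    have h1 : 8 + 128 * (9 * ℓ₁ + ℓ₁) ^ 2 ≤ 12808 * ℓ₁ ^ 2 := by nlinarith only [hℓ1]
    calc C * E * (8 + 128 * (9 * ℓ₁ + ℓ₁) ^ 2) ≤ (1736 * (C * D) * ℓ₁) * (12808 * ℓ₁ ^ 2) := mul_le_mul hCE h1 (by positivity) (by positivity)
      _ = _ := by ring
  have hTd : card' * Tb ≤ 10648 * ℓ₁ ^ 3 * (tbc * (C * D)) := mul_le_mul hcardQ hTb hTb0 (by positivity)
  have hN2 : sN * (Real.sqrt card * Real.sqrt ((C * D) ^ 2 * (3 * (45 * ℓ₁)) * (8 + 128 * (9 * ℓ₁) ^ 2)) + (card' * G + C * E * (8 + 128 * (9 * ℓ₁ + ℓ₁) ^ 2)))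
      + sN * (card' * Tb) ≤ (sN * C * (22341248 + 10648 * (g1c + tbc))) * ℓ₁ * (D * ℓ₁ ^ 2) := by
    have h1 : Real.sqrt card * Real.sqrt ((C * D) ^ 2 * (3 * (45 * ℓ₁)) * (8 + 128 * (9 * ℓ₁) ^ 2)) + (card' * G + C * E * (8 + 128 * (9 * ℓ₁ + ℓ₁) ^ 2))
        + card' * Tb ≤ (22341248 + 10648 * (g1c + tbc)) * (C * D) * ℓ₁ ^ 3 := by linarith only [hTa, hTbG, hTc, hTd]
    have h2 := mul_le_mul_of_nonneg_left h1 hsN0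
    have e : sN * ((22341248 + 10648 * (g1c + tbc)) * (C * D) * ℓ₁ ^ 3) = (sN * C * (22341248 + 10648 * (g1c + tbc))) * ℓ₁ * (D * ℓ₁ ^ 2) := by ring
    rw [mul_add] at h2
    linarith only [h2, e]
  -- ===== H1 =====
  have hHa : W₀ * (Ω * (sN * (Real.sqrt card' * Tb))) ≤ 104 * w * Ω * sN * tbc * (C * D) * ℓ₁ ^ 3 := by
    have h1 : Real.sqrt card' * Tb ≤ (104 * ℓ₁ * s) * (tbc * (C * D)) := mul_le_mul hsqcard' hTb hTb0 (by positivity)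
    have h2 : Ω * (sN * (Real.sqrt card' * Tb)) ≤ Ω * (sN * ((104 * ℓ₁ * s) * (tbc * (C * D)))) :=
      mul_le_mul_of_nonneg_left (mul_le_mul_of_nonneg_left h1 hsN0) hΩ
    calc _ ≤ (w * ℓ₁ * s) * (Ω * (sN * ((104 * ℓ₁ * s) * (tbc * (C * D))))) :=
          mul_le_mul hW₀ h2 (mul_nonneg hΩ (mul_nonneg hsN0 (mul_nonneg (Real.sqrt_nonneg _) hTb0))) (mul_nonneg (mul_nonneg hw hℓ0.le) hs0.le)
      _ = 104 * w * Ω * sN * tbc * (C * D) * (ℓ₁ * ℓ₁) * (s * s) := by ring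
      _ = _ := by rw [hss, h3]; ring
  have hHb : W₀ * (Ω * Real.sqrt (N * (2 * (card' * G ^ 2) + 2 * ((C * E) ^ 2 * (8 + 192 * (9 * ℓ₁ + ℓ₁)))))) ≤ w * Ω * sN * Real.sqrt hhc * (C * D) * ℓ₁ ^ 3 := by
    have hG2 : G ^ 2 ≤ (g1c * (C * D)) ^ 2 := pow_le_pow_left₀ hG0 hG 2
    have hCE2 : (C * E) ^ 2 ≤ (1736 * (C * D) * ℓ₁) ^ 2 := pow_le_pow_left₀ (mul_nonneg hC hE0) hCE 2
    have hrad : 2 * (card' * G ^ 2) + 2 * ((C * E) ^ 2 * (8 + 192 * (9 * ℓ₁ + ℓ₁))) ≤ (hhc * (C * D) ^ 2) * ℓ₁ ^ 3 := by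
      rw [hhhc]
      have a1 : card' * G ^ 2 ≤ (10648 * ℓ₁ ^ 3) * (g1c * (C * D)) ^ 2 := mul_le_mul hcardQ hG2 (sq_nonneg _) (by positivity)
      have h8 : 8 + 192 * (9 * ℓ₁ + ℓ₁) ≤ 1928 * ℓ₁ := by linarith only [hℓ1]
      have a2 : (C * E) ^ 2 * (8 + 192 * (9 * ℓ₁ + ℓ₁)) ≤ (1736 * (C * D) * ℓ₁) ^ 2 * (1928 * ℓ₁) := mul_le_mul hCE2 h8 (by positivity) (sq_nonneg _)
      linarith only [a1, a2]
    have h1 : Real.sqrt (N * (2 * (card' * G ^ 2) + 2 * ((C * E) ^ 2 * (8 + 192 * (9 * ℓ₁ + ℓ₁))))) ≤ sN * (Real.sqrt hhc * (C * D)) * ℓ₁ * s := by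
      have h2 : (N : ℝ) * (2 * (card' * G ^ 2) + 2 * ((C * E) ^ 2 * (8 + 192 * (9 * ℓ₁ + ℓ₁)))) ≤ N * ((hhc * (C * D) ^ 2) * ℓ₁ ^ 3) :=
        mul_le_mul_of_nonneg_left hrad (Nat.cast_nonneg _)
      refine (Real.sqrt_le_sqrt h2).trans (le_of_eq ?_)
      rw [Real.sqrt_mul (Nat.cast_nonneg _), sqrt_mul_cube (mul_nonneg hhhc0 (sq_nonneg _)) hℓ0.le, Real.sqrt_mul hhhc0, Real.sqrt_sq hCD]
      ring
    calc _ ≤ (w * ℓ₁ * s) * (Ω * (sN * (Real.sqrt hhc * (C * D)) * ℓ₁ * s)) :=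
          mul_le_mul hW₀ (mul_le_mul_of_nonneg_left h1 hΩ) (mul_nonneg hΩ (Real.sqrt_nonneg _)) (mul_nonneg (mul_nonneg hw hℓ0.le) hs0.le)
      _ = w * Ω * sN * Real.sqrt hhc * (C * D) * (ℓ₁ * ℓ₁) * (s * s) := by ring
      _ = _ := by rw [hss, h3]; ring
  have hH1 : W₀ * (3 * (Ω * (sN * (Real.sqrt card' * Tb)) + Ω * Real.sqrt (N * (2 * (card' * G ^ 2) + 2 * ((C * E) ^ 2 * (8 + 192 * (9 * ℓ₁ + ℓ₁)))))))
      ≤ (3 * w * Ω * sN * C * (104 * tbc + Real.sqrt hhc)) * ℓ₁ * (D * ℓ₁ ^ 2) := by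
    have e : W₀ * (3 * (Ω * (sN * (Real.sqrt card' * Tb)) + Ω * Real.sqrt (N * (2 * (card' * G ^ 2) + 2 * ((C * E) ^ 2 * (8 + 192 * (9 * ℓ₁ + ℓ₁)))))))
        = 3 * (W₀ * (Ω * (sN * (Real.sqrt card' * Tb))) + W₀ * (Ω * Real.sqrt (N * (2 * (card' * G ^ 2) + 2 * ((C * E) ^ 2 * (8 + 192 * (9 * ℓ₁ + ℓ₁))))))) := by ring
    have e2 : (3 * w * Ω * sN * C * (104 * tbc + Real.sqrt hhc)) * ℓ₁ * (D * ℓ₁ ^ 2) = 3 * (104 * w * Ω * sN * tbc * (C * D) * ℓ₁ ^ 3 + w * Ω * sN * Real.sqrt hhc * (C * D) * ℓ₁ ^ 3) := by ring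
    rw [e, e2]
    linarith only [hHa, hHb]
  -- ===== S1 =====
  have hcR0 : 0 ≤ cR := by rw [hcRdef]; positivity
  have hcR : cR * ℓ₁ ^ 2 ≤ (3 * (92 * α + 484 * α ^ 2)) * (C * D) := by
    have e : cR * ℓ₁ ^ 2 = 3 * ((J2 * ℓ₁ ^ 2) * (C * D) + 6 * (L1 * ℓ₁) * (C * D)) := by rw [hcRdef]; field_simp; ring
    rw [e]
    have a1 : (J2 * ℓ₁ ^ 2) * (C * D) ≤ (26 * α + 484 * α ^ 2) * (C * D) := mul_le_mul_of_nonneg_right hJ2 hCD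
    have a2 : 6 * (L1 * ℓ₁) * (C * D) ≤ 6 * (11 * α) * (C * D) := mul_le_mul_of_nonneg_right (by linarith only [hL1]) hCD
    linarith only [a1, a2]
  have hcS0 : 0 ≤ cS := by rw [hcSdef]; positivity
  have hcS : cS * ℓ₁ ≤ 132 * α * (C * D) := by
    have e : cS * ℓ₁ = 12 * ((L1 * ℓ₁) * (C * D)) := by rw [hcSdef]; ring
    rw [e]
    have h1 := mul_le_mul_of_nonneg_right hL1 hCD
    linarith only [h1]
  have hR1 : (2 * (cR ^ 2 * (3 * (45 * ℓ₁)) * (8 + 128 * (9 * ℓ₁) ^ 2)) + 2 * (cS ^ 2 * (8 + 192 * (9 * ℓ₁)))) * ℓ₁ ≤ (C * D * Real.sqrt s1c) ^ 2 := by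
    have e0 : (C * D * Real.sqrt s1c) ^ 2 = s1c * (C * D) ^ 2 := by rw [mul_pow, Real.sq_sqrt hs1c0]; ring
    rw [e0, hs1c]
    have a1 : cR ^ 2 * (3 * (45 * ℓ₁)) * (8 + 128 * (9 * ℓ₁) ^ 2) * ℓ₁ ≤ 1400760 * (cR * ℓ₁ ^ 2) ^ 2 := by
      have h1 : (3 * (45 * ℓ₁)) * (8 + 128 * (9 * ℓ₁) ^ 2) * ℓ₁ ≤ 1400760 * ℓ₁ ^ 4 := by linarith only [hℓ24]
      have h2 := mul_le_mul_of_nonneg_left h1 (sq_nonneg cR)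
      linarith only [h2]
    have a2 : (cR * ℓ₁ ^ 2) ^ 2 ≤ ((3 * (92 * α + 484 * α ^ 2)) * (C * D)) ^ 2 := pow_le_pow_left₀ (mul_nonneg hcR0 (pow_nonneg hℓ0.le 2)) hcR 2
    have a3 : cS ^ 2 * (8 + 192 * (9 * ℓ₁)) * ℓ₁ ≤ 1736 * (cS * ℓ₁) ^ 2 := by
      have h1 : (8 + 192 * (9 * ℓ₁)) * ℓ₁ ≤ 1736 * ℓ₁ ^ 2 := by linarith only [hℓsq]
      have h2 := mul_le_mul_of_nonneg_left h1 (sq_nonneg cS)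
      linarith only [h2]
    have a4 : (cS * ℓ₁) ^ 2 ≤ (132 * α * (C * D)) ^ 2 := pow_le_pow_left₀ (mul_nonneg hcS0 hℓ0.le) hcS 2
    linarith only [a1, a2, a3, a4]
  have hsR1 : Real.sqrt (2 * (cR ^ 2 * (3 * (45 * ℓ₁)) * (8 + 128 * (9 * ℓ₁) ^ 2)) + 2 * (cS ^ 2 * (8 + 192 * (9 * ℓ₁)))) ≤ C * D * Real.sqrt s1c / s := by
    have h := sqrt_le_div_sqrt_of_mul_le hℓ0 hR1
    rwa [Real.sqrt_sq (by positivity)] at h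
  -- a3, a2, a4
  have hLT0 : 0 < LT := lt_of_lt_of_le hℓ0 hLT
  have hLTne : LT ≠ 0 := hLT0.ne'
  have ha30 : 0 ≤ a3 := by rw [ha3def]; positivity
  have ha3 : a3 * ℓ₁ ^ 2 ≤ 1737 * D := by
    have hinv : (LT ^ 3)⁻¹ ≤ (ℓ₁ ^ 3)⁻¹ := by
      apply inv_anti₀ (pow_pos hℓ0 3)
      exact pow_le_pow_left₀ hℓ0.le hLT 3
    have h1 : (LT ^ 3)⁻¹ * E * ℓ₁ ^ 2 ≤ (ℓ₁ ^ 3)⁻¹ * E * ℓ₁ ^ 2 :=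
      mul_le_mul_of_nonneg_right (mul_le_mul_of_nonneg_right hinv hE0) (by positivity)
    have h2 : (ℓ₁ ^ 3)⁻¹ * E * ℓ₁ ^ 2 ≤ 1736 * D := by
      have e : (ℓ₁ ^ 3)⁻¹ * E * ℓ₁ ^ 2 = E / ℓ₁ := by field_simp
      rw [e, div_le_iff₀ hℓ0]
      exact hE
    have e2 : a3 * ℓ₁ ^ 2 = D + (LT ^ 3)⁻¹ * E * ℓ₁ ^ 2 := by rw [ha3def]; field_simp
    rw [e2]
    linarith only [h1, h2]
  have ha2 : a2 * ℓ₁ = 9 * (C * D) := by rw [ha2def]; field_simp; ring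
  have ha4 : a4 * ℓ₁ ^ 2 = 27 * (C * D) := by rw [ha4def]; field_simp; ring
  have hR2 : (N * (4 * (card * a3 ^ 2) + 4 * (a2 ^ 2 * (8 + 192 * (9 * ℓ₁))) + 2 * (a4 ^ 2 * (2 * (3 * (45 * ℓ₁))) * (8 + 128 * (9 * ℓ₁) ^ 2)))) * ℓ₁
      ≤ (sN * D * Real.sqrt s2c) ^ 2 := by
    have e0 : (sN * D * Real.sqrt s2c) ^ 2 = N * (s2c * D ^ 2) := by rw [mul_pow, mul_pow, hsNsq, Real.sq_sqrt hs2c0]; ring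
    rw [e0, mul_assoc]
    refine mul_le_mul_of_nonneg_left ?_ (Nat.cast_nonneg _)
    rw [hs2c]
    have b1 : card * a3 ^ 2 * ℓ₁ ≤ 8000 * (a3 * ℓ₁ ^ 2) ^ 2 := by
      have h1 := mul_le_mul_of_nonneg_right (mul_le_mul_of_nonneg_right hcardP (sq_nonneg a3)) hℓ0.le
      have e : 8000 * ℓ₁ ^ 3 * a3 ^ 2 * ℓ₁ = 8000 * (a3 * ℓ₁ ^ 2) ^ 2 := by ring
      linarith only [h1, e]
    have b1' : (a3 * ℓ₁ ^ 2) ^ 2 ≤ (1737 * D) ^ 2 := pow_le_pow_left₀ (mul_nonneg ha30 (pow_nonneg hℓ0.le 2)) ha3 2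
    have b2 : a2 ^ 2 * (8 + 192 * (9 * ℓ₁)) * ℓ₁ ≤ 1736 * (a2 * ℓ₁) ^ 2 := by
      have h1 : (8 + 192 * (9 * ℓ₁)) * ℓ₁ ≤ 1736 * ℓ₁ ^ 2 := by linarith only [hℓsq]
      have h2 := mul_le_mul_of_nonneg_left h1 (sq_nonneg a2)
      linarith only [h2]
    have b3 : a4 ^ 2 * (2 * (3 * (45 * ℓ₁))) * (8 + 128 * (9 * ℓ₁) ^ 2) * ℓ₁ ≤ 2801520 * (a4 * ℓ₁ ^ 2) ^ 2 := by
      have h1 : (2 * (3 * (45 * ℓ₁))) * (8 + 128 * (9 * ℓ₁) ^ 2) * ℓ₁ ≤ 2801520 * ℓ₁ ^ 4 := by linarith only [hℓ24]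
      have h2 := mul_le_mul_of_nonneg_left h1 (sq_nonneg a4)
      linarith only [h2]
    rw [ha2] at b2; rw [ha4] at b3
    linarith only [b1, b1', b2, b3]
  have hsR2 : Real.sqrt (N * (4 * (card * a3 ^ 2) + 4 * (a2 ^ 2 * (8 + 192 * (9 * ℓ₁))) + 2 * (a4 ^ 2 * (2 * (3 * (45 * ℓ₁))) * (8 + 128 * (9 * ℓ₁) ^ 2))))
      ≤ sN * D * Real.sqrt s2c / s := by
    have h := sqrt_le_div_sqrt_of_mul_le hℓ0 hR2
    rwa [Real.sqrt_sq (by positivity)] at h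
  have hS1 : W₀ * (5 * A * (Ω * (sN * Real.sqrt (2 * (cR ^ 2 * (3 * (45 * ℓ₁)) * (8 + 128 * (9 * ℓ₁) ^ 2)) + 2 * (cS ^ 2 * (8 + 192 * (9 * ℓ₁)))))
      + Ω * Real.sqrt (N * (4 * (card * a3 ^ 2) + 4 * (a2 ^ 2 * (8 + 192 * (9 * ℓ₁))) + 2 * (a4 ^ 2 * (2 * (3 * (45 * ℓ₁))) * (8 + 128 * (9 * ℓ₁) ^ 2))))))
      ≤ (5 * w * cA * Ω * sN * (C * Real.sqrt s1c + Real.sqrt s2c)) * ℓ₁ * (D * ℓ₁ ^ 2) := by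
    have hin : Ω * (sN * Real.sqrt (2 * (cR ^ 2 * (3 * (45 * ℓ₁)) * (8 + 128 * (9 * ℓ₁) ^ 2)) + 2 * (cS ^ 2 * (8 + 192 * (9 * ℓ₁)))))
        + Ω * Real.sqrt (N * (4 * (card * a3 ^ 2) + 4 * (a2 ^ 2 * (8 + 192 * (9 * ℓ₁))) + 2 * (a4 ^ 2 * (2 * (3 * (45 * ℓ₁))) * (8 + 128 * (9 * ℓ₁) ^ 2))))
        ≤ Ω * sN * D * (C * Real.sqrt s1c + Real.sqrt s2c) / s := by
      have a1 := mul_le_mul_of_nonneg_left (mul_le_mul_of_nonneg_left hsR1 hsN0) hΩ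
      have a2 := mul_le_mul_of_nonneg_left hsR2 hΩ
      have e : Ω * (sN * (C * D * Real.sqrt s1c / s)) + Ω * (sN * D * Real.sqrt s2c / s) = Ω * sN * D * (C * Real.sqrt s1c + Real.sqrt s2c) / s := by
        rw [div_eq_mul_inv, div_eq_mul_inv, div_eq_mul_inv]; ring
      linarith only [a1, a2, e]
    have hin0 : 0 ≤ Ω * (sN * Real.sqrt (2 * (cR ^ 2 * (3 * (45 * ℓ₁)) * (8 + 128 * (9 * ℓ₁) ^ 2)) + 2 * (cS ^ 2 * (8 + 192 * (9 * ℓ₁)))))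
        + Ω * Real.sqrt (N * (4 * (card * a3 ^ 2) + 4 * (a2 ^ 2 * (8 + 192 * (9 * ℓ₁))) + 2 * (a4 ^ 2 * (2 * (3 * (45 * ℓ₁))) * (8 + 128 * (9 * ℓ₁) ^ 2)))) :=
      add_nonneg (mul_nonneg hΩ (mul_nonneg hsN0 (Real.sqrt_nonneg _))) (mul_nonneg hΩ (Real.sqrt_nonneg _))
    have h1 : 5 * A * (Ω * (sN * Real.sqrt (2 * (cR ^ 2 * (3 * (45 * ℓ₁)) * (8 + 128 * (9 * ℓ₁) ^ 2)) + 2 * (cS ^ 2 * (8 + 192 * (9 * ℓ₁)))))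
        + Ω * Real.sqrt (N * (4 * (card * a3 ^ 2) + 4 * (a2 ^ 2 * (8 + 192 * (9 * ℓ₁))) + 2 * (a4 ^ 2 * (2 * (3 * (45 * ℓ₁))) * (8 + 128 * (9 * ℓ₁) ^ 2)))))
        ≤ 5 * (cA * ℓ₁ ^ 2) * (Ω * sN * D * (C * Real.sqrt s1c + Real.sqrt s2c) / s) :=
      mul_le_mul (mul_le_mul_of_nonneg_left hA (by norm_num)) hin hin0 (by linarith only [hA0.trans hA])
    refine (mul_le_mul hW₀ h1 (mul_nonneg (mul_nonneg (by norm_num) hA0) hin0) (mul_nonneg (mul_nonneg hw hℓ0.le) hs0.le)).trans (le_of_eq ?_)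
    have hsinv : s * s⁻¹ = 1 := mul_inv_cancel₀ hsne
    rw [div_eq_mul_inv]
    calc w * ℓ₁ * s * (5 * (cA * ℓ₁ ^ 2) * (Ω * sN * D * (C * Real.sqrt s1c + Real.sqrt s2c) * s⁻¹))
        = (5 * w * cA * Ω * sN * (C * Real.sqrt s1c + Real.sqrt s2c)) * ℓ₁ * (D * ℓ₁ ^ 2) * (s * s⁻¹) := by ring
      _ = _ := by rw [hsinv, mul_one]
  linarith only [hN2, hH1, hS1]

end Summit.QuantumFields.YangMills.Theorems.Prop7TransplantGen1Arithmetic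

end
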